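import Literature.NumberTheory.EllipticCurves.MultiplicativeReductionBaseChangeTorsionProofs
import Literature.NumberTheory.EllipticCurves.MultiplicativeReductionJValuationProofs
import HarnessLib

/-!
# Pointwise-rational `p`-torsion over `K ⊇ F` at a multiplicative place `v ∤ p` of `E/F` with
# `p ∤ ord_v(Δ_min)` forces `p ∣ e(w|v)`: the `p`-division field is RAMIFIED at `v`
# (Silverman *ATAEC* V.6 Prop. 6.1 / Ex. 5.13 (b); the ramification half of [IUTchI] Ex. 3.2 (iv))

`Proofs` file (theorems only: no definition, no named fact), topic `NumberTheory/EllipticCurves`;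
sequel of `MultiplicativeTrivialTorsionDvdOrdProofs` (`p ∣ ord_w(Δ_min(E_K))` when `Γ_K` fixes
`E_K[p]` pointwise at a multiplicative `w ∤ p`) and `MultiplicativeReductionBaseChangeTorsionProofs`
(multiplicative reduction of `E/F` at `v` survives the base change to such a `K` at `w ∣ v`).

J. H. Silverman, *Advanced Topics in the Arithmetic of Elliptic Curves*, GTM 151 (1994), V.6
Prop. 6.1 (p. 410) and Exercise 5.13 (b): at a multiplicative place the inertia group acts on
`E[p] ≅ ⟨ζ_p, q^{1/p}⟩` through `(1 ord_v(q); 0 1)`; so when `p ∤ ord_v(q) = ord_v(Δ_min)` the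
extension `F_v(E[p])/F_v` is ramified, of ramification index divisible by (indeed equal to) `p`.
GLOBAL number-field form PROVED here, with NO Tate curve beyond what the tree already proved: for
`E/F` elliptic over a number field, `K ⊇ F` a number field over which the `p`-torsion of
`E_K := E ⊗_F K` is pointwise `Γ_K`-invariant (i.e. `K ⊇ F(E[p])`), `p ≥ 3` prime, `v` a place of
`F` of multiplicative reduction, `w ∣ v` a place of `K` with `w ∤ p`:

* `ordMinimalDiscriminant_baseChange_eq_ramificationIdx_mul` — `ord_w(Δ_min(E_K)) = e(w|v)·ord_v(Δ_min(E))`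
  whenever `E_K` is multiplicative at `w` (Silverman *AEC* VII.5.1 (b): both sides are `−ord(j)`;
  Mathlib `valuation_liesOver`);
* **`dvd_ramificationIdx_of_forall_smul_geomTorsion_baseChange_eq`** — if `p ∤ ord_v(Δ_min(E))` then
  `p ∣ e(w|v)`; hence `p ≤ e(w|v)`, `1 < e(w|v)` (`w` is RAMIFIED over `F`), and — absolutely —
  `p ∣ e(w|p_w)`, `1 < e(w|p_w)` (`w` is ramified over `ℚ`):
  `le_ramificationIdx_…`, `one_lt_ramificationIdx_…`, `dvd_absRamificationIdx_…`,
  `one_lt_absRamificationIdx_…`, `two_le_absRamificationIdx_…`.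

Route: `E_K` is multiplicative at `w` (`hasMultiplicativeReductionAt_baseChange_of_forall_smul_geomTorsion_eq`,
[IUTchIV] Prop. 1.8 (v)); `p ∣ ord_w(Δ_min(E_K))` (`dvd_ordMinimalDiscriminant_of_forall_smul_geomTorsion_eq`,
the contrapositive of the tree's transvection theorem); `ord_w(Δ_min(E_K)) = e(w|v)·ord_v(Δ_min(E))`;
`p` prime and `p ∤ ord_v(Δ_min(E))`.

Consumers (cell abc-iut; the locator records WHERE it is used — the mathematics is classical):
[IUTchI] Def. 3.1 (c) "`l` is prime to … the orders of the `q`-parameters of `E_F`" with (e)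
"`K := F(E_F[l])`", whence every place of `K` over `𝕍(F)^bad` is ramified over `F` with index
divisible by `l` (the tree's `ThetaData.l_dvd_ramificationIdx_of_under_mem_VFbad`, stated over the typed
initial Θ-data; here the curve-level statement); [J-IV] (K. Joshi, arXiv:2403.10430v2) Lemma 6.7.1
(4) ⟹ (2) "`v_ℚ` in the image of `Supp(q_L)` ⟹ `v_ℚ` ramifies in `L′ = L(C[ℓ])`", which needs exactly
the rider `ℓ ∤ ord_v(q_v)` (his Lemma 5.8.7 (2)). Nothing here bears on [IUTchIII] Cor. 3.12.

## References
* [SilvermanATAEC1994] J. H. Silverman, GTM 151 (1994), V.6 Prop. 6.1 (p. 410), Exercise 5.13 (b).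
* [SilvermanAEC2009] J. H. Silverman, *The Arithmetic of Elliptic Curves*, 2nd ed., VII.5 Prop. 5.1 (b).
* [SerreInventiones1972] J.-P. Serre, Invent. Math. 15 (1972), §1.12.
* [Mochizuki2012] S. Mochizuki, *Inter-universal Teichmüller theory I*, kurims manuscript (May 2020),
  Def. 3.1 (c)(e) pp. 61–62, Example 3.2 (iv) p. 71 (consumer loci only).
-/

noncomputable section

open scoped Classical
open NumberField IsDedekindDomain

universe u

namespace WeierstrassCurve

open Literature.NumberTheory.EllipticCurves Literature.NumberTheory.GaloisRepresentations Field

variable {F : Type u} [Field F] [NumberField F] {K : Type u} [Field K] [NumberField K] [Algebra F K]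
  (E : WeierstrassCurve F) {v : HeightOneSpectrum (𝓞 F)} {w : HeightOneSpectrum (𝓞 K)}

omit [NumberField F] [NumberField K] in
/-- `E ⊗_F K` is elliptic when `E` is. [folklore] -/
private theorem isElliptic_baseChange'' [E.IsElliptic] : (E.baseChange K).IsElliptic := by
  unfold WeierstrassCurve.baseChange; infer_instance

/-- **`ord_w(Δ_min(E_K)) = e(w|v) · ord_v(Δ_min(E))`** for `E/F` multiplicative at `v` and `E_K`
multiplicative at `w ∣ v` (Silverman *AEC* VII.5.1 (b): `−ord(j) = ord(Δ_min)` at a multiplicative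
place, on both floors; `ord_w = e(w|v)·ord_v` on `F`, Mathlib `valuation_liesOver`).
[cite: SilvermanAEC2009, VII.5 Prop. 5.1(b)] -/
theorem ordMinimalDiscriminant_baseChange_eq_ramificationIdx_mul [E.IsElliptic]
    [w.asIdeal.LiesOver v.asIdeal] (hmult : E.HasMultiplicativeReductionAt v)
    (hmultK : (E.baseChange K).HasMultiplicativeReductionAt w) :
    (E.baseChange K).ordMinimalDiscriminant w =
      v.asIdeal.ramificationIdx' w.asIdeal * E.ordMinimalDiscriminant v := by
  haveI := E.isElliptic_baseChange'' (K := K)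
  have hj : (E.baseChange K).j = algebraMap F K E.j := by
    unfold WeierstrassCurve.baseChange; exact E.map_j _
  have h : ((E.baseChange K).ordMinimalDiscriminant w : ℤ) =
      (v.asIdeal.ramificationIdx' w.asIdeal : ℤ) * (E.ordMinimalDiscriminant v : ℤ) := by
    rw [← (E.baseChange K).log_valuation_j_eq_ordMinimalDiscriminant_of_hasMultiplicativeReductionAt w
        hmultK, ← E.log_valuation_j_eq_ordMinimalDiscriminant_of_hasMultiplicativeReductionAt v hmult,
      hj, ← IsDedekindDomain.HeightOneSpectrum.valuation_liesOver K v w E.j, WithZero.log_pow]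
    simp
  exact_mod_cast h

/-- **Pointwise-rational `p`-torsion over `K` forces `p ∣ e(w|v)` at a multiplicative place `v` of
`E/F` with `p ∤ ord_v(Δ_min)`** (Silverman *ATAEC* V.6 Prop. 6.1, Ex. 5.13 (b)): `E/F` elliptic,
multiplicative at `v`; `p ≥ 3` prime; `w ∣ v` a place of the number field `K ⊇ F` with `w ∤ p`;
every `σ ∈ Γ_K` fixes every point of `E_K[p]`; `p ∤ ord_v(Δ_min(E))`. Then `p ∣ e(w|v)`.
[cite: SilvermanATAEC1994, V.6 Prop. 6.1 (p. 410)] [cite: SerreInventiones1972, §1.12] -/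
theorem dvd_ramificationIdx_of_forall_smul_geomTorsion_baseChange_eq [E.IsElliptic]
    [w.asIdeal.LiesOver v.asIdeal] (hmult : E.HasMultiplicativeReductionAt v) {p : ℕ} (hp : p.Prime)
    (hp3 : 3 ≤ p) (hpw : (p : 𝓞 K) ∉ w.asIdeal)
    (hfix : ∀ (σ : absoluteGaloisGroup K) (Q : geomTorsion (E.baseChange K) (p : ℤ)), σ • Q = Q)
    (hndvd : ¬ p ∣ E.ordMinimalDiscriminant v) :
    p ∣ v.asIdeal.ramificationIdx' w.asIdeal := by
  haveI := E.isElliptic_baseChange'' (K := K)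
  have hmultK : (E.baseChange K).HasMultiplicativeReductionAt w :=
    E.hasMultiplicativeReductionAt_baseChange_of_forall_smul_geomTorsion_eq hmult hp hp3 hpw hfix
  have hdvd : p ∣ (E.baseChange K).ordMinimalDiscriminant w :=
    (E.baseChange K).dvd_ordMinimalDiscriminant_of_forall_smul_geomTorsion_eq hmultK hp hpw hfix
  rw [E.ordMinimalDiscriminant_baseChange_eq_ramificationIdx_mul hmult hmultK] at hdvd
  exact ((Nat.Prime.dvd_mul hp).mp hdvd).resolve_right hndvd

/-- Under the same hypotheses **`p ≤ e(w|v)`**. [cite: SilvermanATAEC1994, V.6 Prop. 6.1 (p. 410)] -/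
theorem le_ramificationIdx_of_forall_smul_geomTorsion_baseChange_eq [E.IsElliptic]
    [w.asIdeal.LiesOver v.asIdeal] (hmult : E.HasMultiplicativeReductionAt v) {p : ℕ} (hp : p.Prime)
    (hp3 : 3 ≤ p) (hpw : (p : 𝓞 K) ∉ w.asIdeal)
    (hfix : ∀ (σ : absoluteGaloisGroup K) (Q : geomTorsion (E.baseChange K) (p : ℤ)), σ • Q = Q)
    (hndvd : ¬ p ∣ E.ordMinimalDiscriminant v) :
    p ≤ v.asIdeal.ramificationIdx' w.asIdeal :=
  Nat.le_of_dvd (Nat.pos_of_ne_zero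
      (Ideal.IsDedekindDomain.ramificationIdx'_ne_zero_of_liesOver w.asIdeal v.ne_bot))
    (E.dvd_ramificationIdx_of_forall_smul_geomTorsion_baseChange_eq hmult hp hp3 hpw hfix hndvd)

/-- Under the same hypotheses **`w` is RAMIFIED over `F`: `1 < e(w|v)`** — the `p`-division field of a
curve with a multiplicative place `v` with `p ∤ ord_v(Δ_min)` is ramified at `v`.
[cite: SilvermanATAEC1994, V.6 Prop. 6.1 (p. 410)] -/
theorem one_lt_ramificationIdx_of_forall_smul_geomTorsion_baseChange_eq [E.IsElliptic]
    [w.asIdeal.LiesOver v.asIdeal] (hmult : E.HasMultiplicativeReductionAt v) {p : ℕ} (hp : p.Prime)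
    (hp3 : 3 ≤ p) (hpw : (p : 𝓞 K) ∉ w.asIdeal)
    (hfix : ∀ (σ : absoluteGaloisGroup K) (Q : geomTorsion (E.baseChange K) (p : ℤ)), σ • Q = Q)
    (hndvd : ¬ p ∣ E.ordMinimalDiscriminant v) :
    1 < v.asIdeal.ramificationIdx' w.asIdeal :=
  lt_of_lt_of_le (by omega)
    (E.le_ramificationIdx_of_forall_smul_geomTorsion_baseChange_eq hmult hp hp3 hpw hfix hndvd)

/-! ## Absolute ramification: `e(w|p_w) = e(v|p_w)·e(w|v)` is divisible by `p` -/

/-- `e(w|v) ∣ e(w|p_w)` in the tower `ℤ ⊆ 𝓞_F ⊆ 𝓞_K`: the ramification index is multiplicative in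
towers, `e(w|p_w) = e(v|p_w)·e(w|v)` (Neukirch, Ch. II (6.8) ff.; Mathlib `ramificationIdx'_algebra_tower'`;
`e(w|p_w)` is Mathlib's `w.asIdeal.ramificationIdx ℤ`). [cite: NeukirchANT1999, Ch. I §8 Prop. (8.2) / Ch. II (6.8)] -/
theorem ramificationIdx'_dvd_absRamificationIdx (v : HeightOneSpectrum (𝓞 F))
    (w : HeightOneSpectrum (𝓞 K)) [w.asIdeal.LiesOver v.asIdeal] :
    v.asIdeal.ramificationIdx' w.asIdeal ∣ w.asIdeal.ramificationIdx ℤ := by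
  haveI : v.asIdeal.LiesOver (w.asIdeal.under ℤ) := Ideal.LiesOver.tower_bot w.asIdeal v.asIdeal _
  haveI : w.asIdeal.LiesOver (w.asIdeal.under ℤ) := ⟨rfl⟩
  have hp : w.asIdeal.under ℤ ≠ ⊥ := Ideal.under_ne_bot ℤ w.ne_bot
  rw [← Ideal.ramificationIdx'_eq_ramificationIdx (w.asIdeal.under ℤ) w.asIdeal hp,
    Ideal.ramificationIdx'_algebra_tower' (w.asIdeal.under ℤ) v.asIdeal w.asIdeal]
  exact dvd_mul_left _ _

/-- Under the hypotheses of `dvd_ramificationIdx_of_forall_smul_geomTorsion_baseChange_eq`,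
**`p ∣ e(w|p_w)`**: the absolute ramification index of `w` is divisible by `p`.
[cite: SilvermanATAEC1994, V.6 Prop. 6.1 (p. 410)] -/
theorem dvd_absRamificationIdx_of_forall_smul_geomTorsion_baseChange_eq [E.IsElliptic]
    [w.asIdeal.LiesOver v.asIdeal] (hmult : E.HasMultiplicativeReductionAt v) {p : ℕ} (hp : p.Prime)
    (hp3 : 3 ≤ p) (hpw : (p : 𝓞 K) ∉ w.asIdeal)
    (hfix : ∀ (σ : absoluteGaloisGroup K) (Q : geomTorsion (E.baseChange K) (p : ℤ)), σ • Q = Q)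
    (hndvd : ¬ p ∣ E.ordMinimalDiscriminant v) :
    p ∣ w.asIdeal.ramificationIdx ℤ :=
  (E.dvd_ramificationIdx_of_forall_smul_geomTorsion_baseChange_eq hmult hp hp3 hpw hfix hndvd).trans
    (ramificationIdx'_dvd_absRamificationIdx v w)

/-- Under the same hypotheses **`w` is ramified over `ℚ`: `1 < e(w|p_w)`**.
[cite: SilvermanATAEC1994, V.6 Prop. 6.1 (p. 410)] -/
theorem one_lt_absRamificationIdx_of_forall_smul_geomTorsion_baseChange_eq [E.IsElliptic]
    [w.asIdeal.LiesOver v.asIdeal] (hmult : E.HasMultiplicativeReductionAt v) {p : ℕ} (hp : p.Prime)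
    (hp3 : 3 ≤ p) (hpw : (p : 𝓞 K) ∉ w.asIdeal)
    (hfix : ∀ (σ : absoluteGaloisGroup K) (Q : geomTorsion (E.baseChange K) (p : ℤ)), σ • Q = Q)
    (hndvd : ¬ p ∣ E.ordMinimalDiscriminant v) :
    1 < w.asIdeal.ramificationIdx ℤ := by
  have hpos : 0 < w.asIdeal.ramificationIdx ℤ := Ideal.ramificationIdx_pos _ _
  exact lt_of_lt_of_le (by omega) (Nat.le_of_dvd hpos
    (E.dvd_absRamificationIdx_of_forall_smul_geomTorsion_baseChange_eq hmult hp hp3 hpw hfix hndvd))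

/-- The same as **`2 ≤ e(w|p_w)`** (the shape "`2 ≤ u.asIdeal.ramificationIdx ℤ`" consumed by the
cell's ramification bookkeeping). [cite: SilvermanATAEC1994, V.6 Prop. 6.1 (p. 410)] -/
theorem two_le_absRamificationIdx_of_forall_smul_geomTorsion_baseChange_eq [E.IsElliptic]
    [w.asIdeal.LiesOver v.asIdeal] (hmult : E.HasMultiplicativeReductionAt v) {p : ℕ} (hp : p.Prime)
    (hp3 : 3 ≤ p) (hpw : (p : 𝓞 K) ∉ w.asIdeal)
    (hfix : ∀ (σ : absoluteGaloisGroup K) (Q : geomTorsion (E.baseChange K) (p : ℤ)), σ • Q = Q)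
    (hndvd : ¬ p ∣ E.ordMinimalDiscriminant v) :
    2 ≤ w.asIdeal.ramificationIdx ℤ :=
  E.one_lt_absRamificationIdx_of_forall_smul_geomTorsion_baseChange_eq hmult hp hp3 hpw hfix hndvd

end WeierstrassCurve

end
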